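import Literature.NumberTheory.LFunctions.WeilTwoPrimeDeflM72YDef
import Literature.NumberTheory.LFunctions.WeilTwoPrimeDeflM72YDataPO23
import Literature.NumberTheory.LFunctions.WeilBlockRowsR
import HarnessLib

/-!
# Deflated two-prime certificate M72Y: the materialized odd block agrees with `P_r + Σ μ ĉ ĉᵀ`, rows 20–29

`WeilCert.checkPmRowG` for certificate M72Y (odd block), by `decide +kernel`. Pure proof file; nothing is asserted.
-/

noncomputable section

namespace Literature.NumberTheory.LFunctions

set_option maxHeartbeats 0 in
/-- Row 20 of the materialized odd block is row 20 of `P_r + Σ μ ĉ ĉᵀ` (certificate M72Y). [folklore] -/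
theorem checkPmRowG1_20_weilCertDeflM72Y : weilCertDeflM72YBase.checkPmRowG weilCertDeflM72YP weilCertDeflM72YPmO 1 20 = true := by
  decide +kernel

set_option maxHeartbeats 0 in
/-- Row 21 of the materialized odd block is row 21 of `P_r + Σ μ ĉ ĉᵀ` (certificate M72Y). [folklore] -/
theorem checkPmRowG1_21_weilCertDeflM72Y : weilCertDeflM72YBase.checkPmRowG weilCertDeflM72YP weilCertDeflM72YPmO 1 21 = true := by
  decide +kernel

set_option maxHeartbeats 0 in
/-- Row 22 of the materialized odd block is row 22 of `P_r + Σ μ ĉ ĉᵀ` (certificate M72Y). [folklore] -/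
theorem checkPmRowG1_22_weilCertDeflM72Y : weilCertDeflM72YBase.checkPmRowG weilCertDeflM72YP weilCertDeflM72YPmO 1 22 = true := by
  decide +kernel

set_option maxHeartbeats 0 in
/-- Row 23 of the materialized odd block is row 23 of `P_r + Σ μ ĉ ĉᵀ` (certificate M72Y). [folklore] -/
theorem checkPmRowG1_23_weilCertDeflM72Y : weilCertDeflM72YBase.checkPmRowG weilCertDeflM72YP weilCertDeflM72YPmO 1 23 = true := by
  decide +kernel

set_option maxHeartbeats 0 in
/-- Row 24 of the materialized odd block is row 24 of `P_r + Σ μ ĉ ĉᵀ` (certificate M72Y). [folklore] -/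
theorem checkPmRowG1_24_weilCertDeflM72Y : weilCertDeflM72YBase.checkPmRowG weilCertDeflM72YP weilCertDeflM72YPmO 1 24 = true := by
  decide +kernel

set_option maxHeartbeats 0 in
/-- Row 25 of the materialized odd block is row 25 of `P_r + Σ μ ĉ ĉᵀ` (certificate M72Y). [folklore] -/
theorem checkPmRowG1_25_weilCertDeflM72Y : weilCertDeflM72YBase.checkPmRowG weilCertDeflM72YP weilCertDeflM72YPmO 1 25 = true := by
  decide +kernel

set_option maxHeartbeats 0 in
/-- Row 26 of the materialized odd block is row 26 of `P_r + Σ μ ĉ ĉᵀ` (certificate M72Y). [folklore] -/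
theorem checkPmRowG1_26_weilCertDeflM72Y : weilCertDeflM72YBase.checkPmRowG weilCertDeflM72YP weilCertDeflM72YPmO 1 26 = true := by
  decide +kernel

set_option maxHeartbeats 0 in
/-- Row 27 of the materialized odd block is row 27 of `P_r + Σ μ ĉ ĉᵀ` (certificate M72Y). [folklore] -/
theorem checkPmRowG1_27_weilCertDeflM72Y : weilCertDeflM72YBase.checkPmRowG weilCertDeflM72YP weilCertDeflM72YPmO 1 27 = true := by
  decide +kernel

set_option maxHeartbeats 0 in
/-- Row 28 of the materialized odd block is row 28 of `P_r + Σ μ ĉ ĉᵀ` (certificate M72Y). [folklore] -/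
theorem checkPmRowG1_28_weilCertDeflM72Y : weilCertDeflM72YBase.checkPmRowG weilCertDeflM72YP weilCertDeflM72YPmO 1 28 = true := by
  decide +kernel

set_option maxHeartbeats 0 in
/-- Row 29 of the materialized odd block is row 29 of `P_r + Σ μ ĉ ĉᵀ` (certificate M72Y). [folklore] -/
theorem checkPmRowG1_29_weilCertDeflM72Y : weilCertDeflM72YBase.checkPmRowG weilCertDeflM72YP weilCertDeflM72YPmO 1 29 = true := by
  decide +kernel


end Literature.NumberTheory.LFunctions
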